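import Literature.Geometry.Kaehler.AnalyticSetComponentsProofs
import Mathlib.Analysis.Calculus.Implicit
import Mathlib.Analysis.Calculus.InverseFunctionTheorem.FDeriv
import HarnessLib

/-!
# Lipschitz sections over coercive projections at regular points (towards Lelong's theorem)

A step in the proof of Lelong's theorem ([Chirka1989, §14.1 Thm.],
`Literature/Geometry/Kaehler/HolomorphicChainFacts.lean`): the local volume estimate at a regular
point. In print: over the complement of the critical values the projection `π_I|_A` is locally
biholomorphic and `∫_{reg A ∩ U_I} dV_I = k_I vol U'_I`. Here, quantitatively and without
integration: if `x` is a regular point of `Z` (cut out near `x` by `g` with `dg(x)` onto) and the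
linear map `ℓ : E → ℂ^q` is `c₀`-coercive on the tangent space `T_x Z = ker dg(x)` of dimension
`q`, then near `x` the set `Z` is the image of its projection `ℓ(Z)` under a map `s` which is
Lipschitz with constant `c₀⁻¹ + 1` (implicit function theorem for `g`, inverse function theorem
for `ℓ` on the local parametrisation); consequently `𝓗^d(S) ≤ (c₀⁻¹ + 1)^d 𝓗^d(ℓ(S))` for every
`S ⊆ Z` near `x`, with a constant depending only on `c₀`.

* `Literature.Geometry.Kaehler.SCV.exists_lipschitz_section` — the Lipschitz section `s` with
  `s (ℓ z) = z` on `Z` near `x`.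

## References

* E. M. Chirka, *Complex Analytic Sets*, Kluwer 1989, §2.3, §14.1 [Chirka1989].
-/

open Metric Set Filter Function
open scoped Topology NNReal

namespace Literature.Geometry.Kaehler

namespace SCV

variable {E : Type*} [NormedAddCommGroup E] [NormedSpace ℂ E] [FiniteDimensional ℂ E]

/-- **Lipschitz sections over coercive projections.** Let `Z ∩ U = U ∩ g⁻¹(0)` with `g`
holomorphic on the open set `U ∋ x`, `x ∈ Z`, `dg(x)` surjective, and let `ℓ : E → ℂ^q` be a
continuous linear map which is `c₀`-coercive (`c₀ ‖v‖ ≤ ‖ℓ v‖`, `c₀ > 0`) on the tangent space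
`ker dg(x)`, of dimension `q`. Then there are an open `W ∋ x`, a set `D ⊆ ℂ^q` containing `ℓ(W)`
and a map `s : ℂ^q → E`, Lipschitz on `D` with constant `c₀⁻¹ + 1`, with `s (ℓ z) = z` for all
`z ∈ Z ∩ W` (so `ℓ` is injective on `Z ∩ W` and `S = s (ℓ (S))` for `S ⊆ Z ∩ W`).
[cite: Chirka1989, §14.1 (proof), p. 175] -/
theorem exists_lipschitz_section {Z U : Set E} {x : E} {c q : ℕ} (hU : IsOpen U) (hxU : x ∈ U)
    {g : E → (Fin c → ℂ)} (hg : DifferentiableOn ℂ g U) (hZU : Z ∩ U = U ∩ g ⁻¹' {0})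
    (hxZ : x ∈ Z) (hsurj : Surjective (fderiv ℂ g x)) (ℓ : E →L[ℂ] (Fin q → ℂ)) {c₀ : ℝ}
    (hc₀ : 0 < c₀)
    (hcoer : ∀ v ∈ LinearMap.ker (fderiv ℂ g x : E →ₗ[ℂ] (Fin c → ℂ)), c₀ * ‖v‖ ≤ ‖ℓ v‖)
    (hdim : Module.finrank ℂ (LinearMap.ker (fderiv ℂ g x : E →ₗ[ℂ] (Fin c → ℂ))) = q) :
    ∃ (W : Set E) (D : Set (Fin q → ℂ)) (s : (Fin q → ℂ) → E), IsOpen W ∧ x ∈ W ∧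
      MapsTo ℓ W D ∧ LipschitzOnWith (Real.toNNReal (c₀⁻¹ + 1)) s D ∧
      ∀ z ∈ Z ∩ W, s (ℓ z) = z := by
  haveI : CompleteSpace E := FiniteDimensional.complete ℂ E
  set g' : E →L[ℂ] (Fin c → ℂ) := fderiv ℂ g x with hg'
  haveI : CompleteSpace g'.ker := FiniteDimensional.complete ℂ _
  have hgx : g x = 0 := (hZU.subset ⟨hxZ, hxU⟩).2
  have hstrict : HasStrictFDerivAt g g' x :=
    ((Literature.Analysis.Complex.SCV.contDiffOn_one hg hU).contDiffAt
      (hU.mem_nhds hxU)).hasStrictFDerivAt one_ne_zero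
  have hrange : g'.range = ⊤ := LinearMap.range_eq_top.2 hsurj
  -- the implicit-function parametrisation `G : ker g' → E` of `{g = 0}` near `x`
  set φ := hstrict.implicitFunction g g' hrange with hφ
  set G : g'.ker → E := φ 0 with hG
  have hG0 : G 0 = x := by
    have := hstrict.implicitFunction_apply_image hrange
    rw [hgx] at this
    exact this
  have hGd : HasStrictFDerivAt G g'.ker.subtypeL 0 := by
    have := hstrict.to_implicitFunction hrange
    rwa [hgx] at this
  -- `ℓ ∘ subtypeL` is a linear isomorphism `ker g' ≃ ℂ^q`
  set L₀ : g'.ker →L[ℂ] (Fin q → ℂ) := ℓ.comp g'.ker.subtypeL with hL₀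
  have hL₀coer : ∀ k : g'.ker, c₀ * ‖k‖ ≤ ‖L₀ k‖ := fun k => by
    have := hcoer k k.2
    simpa [hL₀] using this
  have hL₀inj : LinearMap.ker (L₀ : g'.ker →ₗ[ℂ] (Fin q → ℂ)) = ⊥ := by
    rw [LinearMap.ker_eq_bot']
    intro k hk
    have h := hL₀coer k
    rw [show L₀ k = 0 from hk, norm_zero] at h
    have : ‖k‖ ≤ 0 := by nlinarith [norm_nonneg k]
    exact norm_le_zero_iff.1 this
  have hL₀surj : LinearMap.range (L₀ : g'.ker →ₗ[ℂ] (Fin q → ℂ)) = ⊤ := by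
    apply Submodule.eq_top_of_finrank_eq
    rw [LinearMap.finrank_range_of_inj (LinearMap.ker_eq_bot.1 hL₀inj), hdim]
    simp
  set L : g'.ker ≃L[ℂ] (Fin q → ℂ) := ContinuousLinearEquiv.ofBijective L₀ hL₀inj hL₀surj with hL
  have hLcoe : (L : g'.ker →L[ℂ] (Fin q → ℂ)) = L₀ := ContinuousLinearEquiv.coe_ofBijective _ _ _
  have hLsymm_norm : ‖(L.symm : (Fin q → ℂ) →L[ℂ] g'.ker)‖ ≤ c₀⁻¹ := by
    refine ContinuousLinearMap.opNorm_le_bound _ (inv_nonneg.2 hc₀.le) fun y => ?_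
    have h := hL₀coer (L.symm y)
    rw [← hLcoe] at h
    simp only [ContinuousLinearEquiv.coe_coe, ContinuousLinearEquiv.apply_symm_apply] at h
    rw [inv_mul_eq_div, le_div_iff₀ hc₀, mul_comm]
    exact h
  -- the local inverse of `h = ℓ ∘ G` and the section `s = G ∘ h⁻¹`
  set h : g'.ker → (Fin q → ℂ) := fun k => ℓ (G k) with hh
  have hhd : HasStrictFDerivAt h (L : g'.ker →L[ℂ] (Fin q → ℂ)) 0 := by
    rw [hLcoe, hL₀]
    exact ℓ.hasStrictFDerivAt.comp 0 hGd
  set hinv := hhd.localInverse h L 0 with hhinv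
  have hinvd : HasStrictFDerivAt hinv (L.symm : (Fin q → ℂ) →L[ℂ] g'.ker) (h 0) :=
    hhd.to_localInverse
  have hleft : ∀ᶠ k in 𝓝 (0 : g'.ker), hinv (h k) = k := hhd.eventually_left_inverse
  set s : (Fin q → ℂ) → E := fun y => G (hinv y) with hs
  have hh0 : h 0 = ℓ x := by simp [hh, hG0]
  have hsd : HasStrictFDerivAt s (g'.ker.subtypeL.comp (L.symm : (Fin q → ℂ) →L[ℂ] g'.ker))
      (ℓ x) := by
    have h1 : HasStrictFDerivAt G g'.ker.subtypeL (hinv (h 0)) := by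
      have h0 : hinv (h 0) = 0 := by rw [hhinv]; exact hhd.localInverse_apply_image
      rw [h0]; exact hGd
    have := h1.comp (h 0) hinvd
    rwa [hh0] at this
  -- Lipschitz constant from the norm of the derivative
  have hnorm : ‖g'.ker.subtypeL.comp (L.symm : (Fin q → ℂ) →L[ℂ] g'.ker)‖₊ <
      Real.toNNReal (c₀⁻¹ + 1) := by
    rw [← NNReal.coe_lt_coe, coe_nnnorm, Real.coe_toNNReal _ (by positivity)]
    calc ‖g'.ker.subtypeL.comp (L.symm : (Fin q → ℂ) →L[ℂ] g'.ker)‖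
        ≤ ‖g'.ker.subtypeL‖ * ‖(L.symm : (Fin q → ℂ) →L[ℂ] g'.ker)‖ :=
          ContinuousLinearMap.opNorm_comp_le _ _
      _ ≤ 1 * c₀⁻¹ := by
          gcongr
          exact Submodule.norm_subtypeL_le _
      _ < c₀⁻¹ + 1 := by linarith
  obtain ⟨D, hD, hlip⟩ := hsd.exists_lipschitzOnWith_of_nnnorm_lt _ hnorm
  -- the neighbourhood `W`
  have hev1 : ∀ᶠ z in 𝓝 x,
      φ (g z) (hstrict.implicitToOpenPartialHomeomorph g g' hrange z).snd = z :=
    hstrict.eq_implicitFunction hrange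
  have hσ : Tendsto (fun z => (hstrict.implicitToOpenPartialHomeomorph g g' hrange z).snd)
      (𝓝 x) (𝓝 0) := by
    have hc : ContinuousAt (hstrict.implicitToOpenPartialHomeomorph g g' hrange) x :=
      (hstrict.implicitToOpenPartialHomeomorph g g' hrange).continuousAt
        (hstrict.mem_implicitToOpenPartialHomeomorph_source hrange)
    have := (continuous_snd.continuousAt).comp hc
    simp only [ContinuousAt, Function.comp_def,
      HasStrictFDerivAt.implicitToOpenPartialHomeomorph_self] at this
    exact this
  have hev2 : ∀ᶠ z in 𝓝 x,
      hinv (h (hstrict.implicitToOpenPartialHomeomorph g g' hrange z).snd) =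
        (hstrict.implicitToOpenPartialHomeomorph g g' hrange z).snd := hσ.eventually hleft
  have hev3 : ∀ᶠ z in 𝓝 x, ℓ z ∈ D := by
    refine ℓ.continuous.continuousAt.preimage_mem_nhds ?_
    exact hD
  have hev4 : ∀ᶠ z in 𝓝 x, z ∈ U := hU.mem_nhds hxU
  obtain ⟨W, hWsub, hWo, hxW⟩ := _root_.mem_nhds_iff.1 (hev1.and (hev2.and (hev3.and hev4)))
  refine ⟨W, D, s, hWo, hxW, fun z hz => (hWsub hz).2.2.1, hlip, fun z hz => ?_⟩
  obtain ⟨h1, h2, -, h4⟩ := hWsub hz.2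
  have hgz : g z = 0 := (hZU.subset ⟨hz.1, h4⟩).2
  rw [hgz] at h1
  -- `z = G σz`, `ℓ z = h σz`, so `s (ℓ z) = G (hinv (h σz)) = G σz = z`
  set σz := (hstrict.implicitToOpenPartialHomeomorph g g' hrange z).snd with hσz
  have hz' : G σz = z := h1
  calc s (ℓ z) = G (hinv (h σz)) := by rw [← hz']
    _ = G σz := by rw [h2]
    _ = z := hz'

end SCV

end Literature.Geometry.Kaehler
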